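import Summits.AtomisticToContinuum.HydrodynamicLimit.Theorems.BoxDissipativeWeakStrongLocalGibbsFineScaleVariance
import Summits.AtomisticToContinuum.HydrodynamicLimit.Theorems.BoxDissipativeWeakStrongLocalGibbsFineScaleCgibbs

/-!
# `LocalGibbsFineScale` (route `BoxDissipativeWeakStrong`), file 5: `L¹` convergence of the kernel
average under the canonical gas, uniformly in the centre

Support lemmas for item stmt-AtomisticToContinuum-9905. For a kernel family `g_N(x, ·)` as in files
3–4 (measurable, `0 ≤ g_N ≤ C_N`, unit mass, supported in the sup-ball of radius `r_N → 0`, kinetic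
window `C_N/(N+1) → 0`) and the canonical `N+1`-particle hard-sphere gas at small reduced density,
written as the conditioned product law `Ξ⁻¹ · μ^{⊗(N+1)}|_{hard core}` (`posGibbsMeasure_eq`):

* (the conditioned law, the averages and Cauchy–Schwarz are in file `…Cgibbs`;)
* `density_L1_kernel_uniform`: **`∀ δ > 0, ∀ᶠ N, ∀ x, E |(N+1)⁻¹ ∑ᵢ g_N(x, qᵢ) - ρ₀(x)| ≤ δ`** —
  Cauchy–Schwarz (`(E|X|)² ≤ E X²`, as `Var |X| ≥ 0`) on the uniform variance bound of file 4 and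
  the uniform one-point limit of file 3.

References: Spohn 1991, Part I §2.3.
-/

noncomputable section

namespace Summit.AtomisticToContinuum.HydrodynamicLimit.Theorems
namespace LGFS
open MeasureTheory ProbabilityTheory Finset Filter Topology Metric
open Literature.Probability.LatticeModels Literature.MathematicalPhysics.StatisticalMechanics
  Literature.MathematicalPhysics.KineticTheory
open scoped ENNReal

variable {P : DensityProfile} {σ : ℝ}

/-! ### `L¹` convergence of the kernel average, uniformly in the centre -/

/-- **Uniform `L¹` law of large numbers at a kinetic window.** For a kernel family `g_N(x, ·)`
(measurable, `0 ≤ g_N ≤ C_N`, unit mass, supported where `dist y x < r_N`, `r_N → 0`,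
`C_N/(N+1) → 0`) and the canonical hard-sphere gas at small reduced density:
`∀ δ > 0, ∀ᶠ N, ∀ x, E_{Ξ⁻¹μ^{⊗(N+1)}|hc} |(N+1)⁻¹ ∑ᵢ g_N(x, qᵢ) - ρ₀(x)| ≤ δ`. -/
theorem density_L1_kernel_uniform (hs : SmallDensity P σ) {g : ℕ → T3 → T3 → ℝ} {Cg r : ℕ → ℝ}
    (hgm : ∀ N x, Measurable (g N x)) (hg0 : ∀ N x y, 0 ≤ g N x y) (hgC : ∀ N x y, g N x y ≤ Cg N)
    (hg1 : ∀ N x, ∫ y, g N x y = 1) (hsupp : ∀ N x y, g N x y ≠ 0 → dist y x < r N)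
    (hr : Tendsto r atTop (𝓝 0)) (hwin : Tendsto (fun N : ℕ => Cg N / ((N : ℝ) + 1)) atTop (𝓝 0))
    {δ : ℝ} (hδ : 0 < δ) :
    ∀ᶠ N in atTop, ∀ x,
      ∫ q, |((((N + 1 : ℕ) : ℝ))⁻¹ * ∑ i, g N x (q i)) - rhoLim P σ x|
        ∂(ENNReal.ofReal (XiN P σ N (N + 1))⁻¹ •
          (Measure.pi fun _ : Fin (N + 1) => P.μ).restrict
            (hardCoreSet (Ov (hsDiameter σ N)) (univ : Finset (Fin (N + 1))))) ≤ δ := by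
  -- `√δ₁ + δ₂ ≤ δ`
  have hδ2 : 0 < δ / 2 := by positivity
  have hE1 := variance_kernel_uniform hs hgm hg0 hgC hg1 hsupp hr hwin (sq_pos_of_pos hδ2)
  have hE2 := onePt_kernel_uniform hs hgm hg0 hgC hg1 hsupp hr 0 hδ2
  filter_upwards [hE1, hE2] with N hN1 hN2 x
  have hXi := XiN_pos hs.σ_pos.le hs.σ_lt_half hs.ovDensity_lt_one (N := N) (m := N + 1) le_rfl
  set PG := ENNReal.ofReal (XiN P σ N (N + 1))⁻¹ •
    (Measure.pi fun _ : Fin (N + 1) => P.μ).restrict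
      (hardCoreSet (Ov (hsDiameter σ N)) (univ : Finset (Fin (N + 1)))) with hPG
  haveI : IsProbabilityMeasure PG := isProbabilityMeasure_cgibbs hs N
  set A : (Fin (N + 1) → T3) → ℝ := fun q => (((N + 1 : ℕ) : ℝ))⁻¹ * ∑ i, g N x (q i) with hA
  set m := onePt P σ (g N x) N 0 with hm
  have hAm : Measurable A := measurable_avg (hgm N x)
  have hAb : ∀ q, |A q| ≤ Cg N := fun q => abs_avg_le (hg0 N x) (hgC N x) q
  have hCg : 0 ≤ Cg N := (hg0 N x x).trans (hgC N x x)
  have hAmb : ∀ q, |A q - m| ≤ Cg N + |m| := fun q =>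
    (abs_sub _ _).trans (add_le_add (hAb q) le_rfl)
  have hint : ∀ c : ℝ, Integrable (fun q => |A q - c|) PG := fun c =>
    (integrable_const (Cg N + |c|)).mono' (hAm.sub_const c).abs.aestronglyMeasurable
      (ae_of_all _ fun q => by
        rw [Real.norm_eq_abs, abs_abs]
        exact (abs_sub _ _).trans (add_le_add (hAb q) le_rfl))
  -- the second moment is the variance expression
  have hvar : ∫ q, (A q - m) ^ 2 ∂PG ≤ (δ / 2) ^ 2 := by
    rw [hPG, integral_cgibbs_eq hXi.le, inv_mul_eq_div]
    exact hN1 x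
  calc ∫ q, |A q - rhoLim P σ x| ∂PG ≤ ∫ q, (|A q - m| + |m - rhoLim P σ x|) ∂PG := by
        refine integral_mono (hint _) ((hint m).add (integrable_const _)) fun q => ?_
        exact abs_sub_le _ _ _
    _ = (∫ q, |A q - m| ∂PG) + |m - rhoLim P σ x| := by
        rw [integral_add (hint m) (integrable_const _), integral_const, probReal_univ, one_smul]
    _ ≤ Real.sqrt (∫ q, (A q - m) ^ 2 ∂PG) + δ / 2 :=
        add_le_add (integral_abs_le_sqrt (hAm.sub_const m) hAmb) (hN2 x)
    _ ≤ δ / 2 + δ / 2 := by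
        refine add_le_add ((Real.sqrt_le_sqrt hvar).trans (le_of_eq ?_)) le_rfl
        exact Real.sqrt_sq hδ2.le
    _ = δ := by ring

end LGFS
end Summit.AtomisticToContinuum.HydrodynamicLimit.Theorems
end
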